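import Summits.QuantumFields.QCD.Theorems.EulerDescentRetypedContinuumComplementHeavyCalibrationPinnedFamily
import Summits.QuantumFields.QCD.Theorems.EulerDescentRetypedContinuumComplementHeavyCalibrationTransferTwoPoint
import HarnessLib

/-!
# The pinned calibrated family TUNED to a reference renormalisation: ratio convergence from positivity
(helper of stub `stub_heavyCalibration`, line `vitali-mass-descent`, crux
`Summit.QuantumFields.QCD.Theses.EulerDescent.RetypedContinuumComplement`, item stmt-QuantumFields-16903)

The heavy transfer (`…HeavyCalibrationHeavyTransfer`) asks for convergence of the ratios
`λ_k(s) = 𝒞.z(m,s,k)/zb(s,k)` against a reference scheme `(zb, shiftb)` (the heavy body's witness).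
Here the family is CHOSEN for that purpose — given ANY assignment `m ↦ (zb m, shiftb m)` of reference
renormalisations (no regularity in `m` is required of a `CalibratedSpeciesFamily`):

* `exists_tunedCalibratedFamily` — a calibrated family `𝒞` (the pinned family of
  `exists_pinnedCalibratedFamily` with the default `ζ` tuned to the reference) with `𝒞.τ₀ = τ₀`,
  `𝒞.f₀ = f₀`, such that for every `(m, s, k)`: if the reference connected calibrating function
  `C = ⟨Φ_b^s(Θf₀)Φ_b^s(f₀)⟩_conn` has `Re C > 0` then `λ_k(s)² = 1/Re C` (on the positive-real branch
  the calibration pins it — the biting dictionary of `…TransferTwoPoint` —, off it the tuned default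
  does), and otherwise `𝒞.z(m,s,k) = |zb(m,s,k)|`;
* `tendsto_ratio_of_tendsto_ref` — if `zb(m,s,·) > 0` and `C(m,s,k) → c` with `Re c > 0`, then
  `λ_k(s) → (Re c)^{-1/2}`;
* `tendsto_ratio_of_eventually_nonpos` — if `zb(m,s,·) > 0` and eventually `Re C(m,s,k) ≤ 0` then
  `λ_k(s) = 1` eventually; `connectedTwoPoint_null` — for the null species `pseudoIm f f` every
  reference connected function vanishes, so this is their case.

With `…HeavyTransfer` this closes the stub CONDITIONALLY: what is left at a heavy tuple is exactly a
heavy-body witness with `zb > 0`, zero-point function eventually `1`, and `lim_k C(m,s,k)` of positive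
real part for every non-null species `s` (Källén–Lehmann positivity of every non-null channel).
Def-free theorem file; everything here is proved.
-/

noncomputable section

namespace Summit.QuantumFields.QCD.Cruxes.RetypedContinuumComplement.VitaliMassDescent

open scoped BigOperators SchwartzMap
open MeasureTheory Filter Topology
open Literature.MathematicalPhysics.AQFT Literature.Probability.LatticeModels
  Literature.MathematicalPhysics.QuantumLattice Literature.MathematicalPhysics.QuantumFieldTheory

variable {Nf : ℕ}

/-! ### The reference connected calibrating function read over the bare scheme -/

/-- The reference connected calibrating function over `(zb, shiftb)` is `zb²` times the bare one
(`z ≡ 1`, any shifts): real and imaginary parts. [folklore] -/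
theorem ref_connectedTwoPoint_re_im (reg : QCDRegularisation Nf) (m : Fin Nf → ℝ)
    (zb shiftb shift₁ : QCDField Nf → ℕ → ℝ) (k : ℕ) (s : QCDField Nf) (g h : 𝓢(EuclideanSpace ℝ (Fin 4), ℝ)) :
    ((reg.scheme m zb shiftb).connectedTwoPoint k s s g h).re =
        zb s k ^ 2 * ((reg.scheme m (fun _ _ => (1 : ℝ)) shift₁).connectedTwoPoint k s s g h).re ∧
      ((reg.scheme m zb shiftb).connectedTwoPoint k s s g h).im =
        zb s k ^ 2 * ((reg.scheme m (fun _ _ => (1 : ℝ)) shift₁).connectedTwoPoint k s s g h).im := by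
  have ht := connectedTwoPoint_transfer reg m (fun _ _ => (1 : ℝ)) shift₁ zb shiftb k s s one_ne_zero
    one_ne_zero g h
  rw [div_one, ← Complex.ofReal_mul, ← sq] at ht
  rw [ht, Complex.re_ofReal_mul, Complex.im_ofReal_mul]
  exact ⟨rfl, rfl⟩

/-! ### The tuned pinned family -/

/-- **The pinned calibrated family tuned to a reference renormalisation.**  For every `reg`, `τ₀ > 0`,
real `f₀ ≠ 0` in the slab `τ₀/2 ≤ x⁰ ≤ τ₀` and every assignment `m ↦ (zb m, shiftb m)` of reference
renormalisations with `zb` never zero, there is a calibrated species family `𝒞` with `𝒞.τ₀ = τ₀`,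
`𝒞.f₀ = f₀` whose ratios against the reference are PINNED wherever the reference connected
calibrating function `C = ⟨Φ_b^s(Θf₀)Φ_b^s(f₀)⟩_conn` has positive real part — `(𝒞.z/zb)² = 1/Re C` —
and which equals `|zb|` elsewhere. [cite: MontvayMunster1994, §1.7 (1.251)–(1.253) and §5.1] -/
theorem exists_tunedCalibratedFamily (reg : QCDRegularisation Nf) {τ₀ : ℝ} (hτ₀ : 0 < τ₀)
    {f₀ : 𝓢(EuclideanSpace ℝ (Fin 4), ℝ)} (hf₀ : f₀ ≠ 0)
    (hsl : tsupport (f₀ : EuclideanSpace ℝ (Fin 4) → ℝ) ⊆ timeSlab 4 (τ₀ / 2) τ₀)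
    (zb shiftb : (Fin Nf → ℝ) → QCDField Nf → ℕ → ℝ) (hzb : ∀ m s k, zb m s k ≠ 0) :
    ∃ 𝒞 : CalibratedSpeciesFamily reg, 𝒞.τ₀ = τ₀ ∧ 𝒞.f₀ = f₀ ∧
      ∀ (m : Fin Nf → ℝ) (s : QCDField Nf) (k : ℕ),
        (0 < ((reg.scheme m (zb m) (shiftb m)).connectedTwoPoint k s s (thetaTest 4 f₀) f₀).re →
          (𝒞.z m s k / zb m s k) ^ 2 =
            (((reg.scheme m (zb m) (shiftb m)).connectedTwoPoint k s s (thetaTest 4 f₀) f₀).re)⁻¹) ∧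
        (¬ 0 < ((reg.scheme m (zb m) (shiftb m)).connectedTwoPoint k s s (thetaTest 4 f₀) f₀).re →
          𝒞.z m s k = |zb m s k|) := by
  classical
  -- the tuned default
  obtain ⟨ζ, hζ⟩ : ∃ ζ : (Fin Nf → ℝ) → QCDField Nf → ℕ → ℝ, ∀ m s k, ζ m s k =
      if 0 < ((reg.scheme m (zb m) (shiftb m)).connectedTwoPoint k s s (thetaTest 4 f₀) f₀).re then
        |zb m s k| * (Real.sqrt ((reg.scheme m (zb m) (shiftb m)).connectedTwoPoint k s s
          (thetaTest 4 f₀) f₀).re)⁻¹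
      else |zb m s k| := ⟨_, fun _ _ _ => rfl⟩
  have hζpos : ∀ m s k, 0 < ζ m s k := fun m s k => by
    rw [hζ]
    split_ifs with h
    · exact mul_pos (abs_pos.2 (hzb m s k)) (inv_pos.2 (Real.sqrt_pos.2 h))
    · exact abs_pos.2 (hzb m s k)
  obtain ⟨𝒞, hτ, hf, -, hpin⟩ := exists_pinnedCalibratedFamily reg hτ₀ hf₀ hsl ζ hζpos
  refine ⟨𝒞, hτ, hf, fun m s k => ?_⟩
  subst hf
  obtain ⟨hre, him⟩ := ref_connectedTwoPoint_re_im reg m (zb m) (shiftb m) (𝒞.shift m) k s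
    (thetaTest 4 𝒞.f₀) 𝒞.f₀
  obtain ⟨hp₁, hp₂⟩ := hpin m s k
  have hz2 : 0 < zb m s k ^ 2 := sq_pos_iff.2 (hzb m s k)
  constructor
  · intro hpos
    by_cases hbr : 0 < ((reg.scheme m (fun _ _ => (1 : ℝ)) (𝒞.shift m)).connectedTwoPoint k s s
        (thetaTest 4 𝒞.f₀) 𝒞.f₀).re ∧
        ((reg.scheme m (fun _ _ => (1 : ℝ)) (𝒞.shift m)).connectedTwoPoint k s s (thetaTest 4 𝒞.f₀) 𝒞.f₀).im = 0
    · -- the calibration pins `𝒞.z = (Re C₁)^{-1/2}`, `Re C = zb² Re C₁`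
      rw [hp₁ hbr, hre, div_pow, inv_pow, Real.sq_sqrt hbr.1.le, mul_inv, div_eq_mul_inv]
      ring
    · -- the tuned default
      rw [hp₂ hbr, hζ, if_pos hpos, div_pow, mul_pow, inv_pow, Real.sq_sqrt hpos.le, sq_abs,
        mul_div_right_comm, div_self hz2.ne', one_mul]
  · intro hnp
    have hbr : ¬ (0 < ((reg.scheme m (fun _ _ => (1 : ℝ)) (𝒞.shift m)).connectedTwoPoint k s s
        (thetaTest 4 𝒞.f₀) 𝒞.f₀).re ∧
        ((reg.scheme m (fun _ _ => (1 : ℝ)) (𝒞.shift m)).connectedTwoPoint k s s (thetaTest 4 𝒞.f₀) 𝒞.f₀).im = 0) := by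
      rintro ⟨h₁, -⟩
      exact hnp (by rw [hre]; exact mul_pos hz2 h₁)
    rw [hp₂ hbr, hζ, if_neg hnp]

/-! ### Ratio convergence from the tuning -/

/-- **Ratio convergence from positivity of the reference limit.**  If the ratios are pinned by
`(𝒞.z/zb)² = 1/Re C` wherever `Re C > 0` (the tuned family), `zb(m,s,·) > 0`, and the reference
connected calibrating functions `C(m,s,k)` converge to `c` with `Re c > 0`, then
`𝒞.z(m,s,k)/zb(m,s,k) → (Re c)^{-1/2}`. [folklore] -/
theorem tendsto_ratio_of_tendsto_ref {reg : QCDRegularisation Nf} (𝒞 : CalibratedSpeciesFamily reg)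
    (m : Fin Nf → ℝ) (zb : QCDField Nf → ℕ → ℝ) (s : QCDField Nf) (C : ℕ → ℂ)
    (hpin : ∀ k, 0 < (C k).re → (𝒞.z m s k / zb s k) ^ 2 = ((C k).re)⁻¹)
    (hzb : ∀ k, 0 < zb s k) {c : ℂ} (hc : 0 < c.re) (hC : Tendsto C atTop (𝓝 c)) :
    Tendsto (fun k : ℕ => 𝒞.z m s k / zb s k) atTop (𝓝 (Real.sqrt c.re)⁻¹) := by
  have hre : Tendsto (fun k => (C k).re) atTop (𝓝 c.re) := (Complex.continuous_re.tendsto c).comp hC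
  have hev : ∀ᶠ k in atTop, 0 < (C k).re := hre.eventually_const_lt hc
  have hlim : Tendsto (fun k => (Real.sqrt (C k).re)⁻¹) atTop (𝓝 (Real.sqrt c.re)⁻¹) :=
    ((Real.continuous_sqrt.tendsto _).comp hre).inv₀ (Real.sqrt_pos.2 hc).ne'
  refine hlim.congr' (hev.mono fun k hk => ?_)
  have hr : 0 < 𝒞.z m s k / zb s k := div_pos (𝒞.z_pos m s k) (hzb k)
  dsimp only
  rw [← Real.sqrt_sq hr.le, hpin k hk, Real.sqrt_inv]

/-- **Ratio convergence where the reference calibrating function is not positive.**  If the family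
equals `|zb|` wherever `Re C ≤ 0` (the tuned family), `zb(m,s,·) > 0`, and eventually `Re C(m,s,k) ≤ 0`,
then the ratio is eventually `1`, hence converges to `1`. [folklore] -/
theorem tendsto_ratio_of_eventually_nonpos {reg : QCDRegularisation Nf} (𝒞 : CalibratedSpeciesFamily reg)
    (m : Fin Nf → ℝ) (zb : QCDField Nf → ℕ → ℝ) (s : QCDField Nf) (C : ℕ → ℂ)
    (hoff : ∀ k, ¬ 0 < (C k).re → 𝒞.z m s k = |zb s k|) (hzb : ∀ k, 0 < zb s k)
    (hev : ∀ᶠ k in atTop, ¬ 0 < (C k).re) :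
    Tendsto (fun k : ℕ => 𝒞.z m s k / zb s k) atTop (𝓝 1) := by
  refine tendsto_const_nhds.congr' (hev.mono fun k hk => ?_)
  dsimp only
  rw [hoff k hk, abs_of_pos (hzb k), div_self (hzb k).ne']

/-! ### Null species: the reference connected functions vanish -/

/-- The lattice representative of the null species `pseudoIm f f` is the zero Grassmann element. [folklore] -/
theorem insertion_pseudoIm_self {L : ℕ} [NeZero L]
    (U : GaugeConfig 4 L (Matrix.specialUnitaryGroup (Fin 3) ℂ)) (fl : Fin Nf)
    (x : Literature.Probability.LatticeModels.Site 4) :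
    insertion U (QCDField.pseudoIm fl fl : QCDField Nf) x = 0 := by
  simp [insertion]

/-- With a vanishing additive counterterm the smeared null field is zero, so every `n`-point function
containing it vanishes. [folklore] -/
theorem qcdLatticeSchwinger_null_eq_zero (reg : QCDRegularisation Nf) (m : Fin Nf → ℝ)
    (z shift : QCDField Nf → ℕ → ℝ) (k : ℕ) {n : ℕ} (σ : Fin n → QCDField Nf)
    (f : Fin n → 𝓢(EuclideanSpace ℝ (Fin 4), ℝ)) {i : Fin n} {fl : Fin Nf}
    (hi : σ i = QCDField.pseudoIm fl fl) (hsh : shift (QCDField.pseudoIm fl fl) k = 0) :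
    qcdLatticeSchwinger (reg.scheme m z shift) k n σ f = 0 := by
  have hΦ : ∀ (U : GaugeConfig 4 ((reg.scheme m z shift).side k) (Matrix.specialUnitaryGroup (Fin 3) ℂ))
      (g : 𝓢(EuclideanSpace ℝ (Fin 4), ℝ)),
      smearedInsertion (reg.scheme m z shift) k U (QCDField.pseudoIm fl fl) g = 0 := fun U g => by
    unfold smearedInsertion
    refine Finset.sum_eq_zero fun x _ => ?_
    rw [insertion_pseudoIm_self, show (reg.scheme m z shift).shift (QCDField.pseudoIm fl fl) k = 0 from hsh,
      Complex.ofReal_zero, map_zero, sub_zero, smul_zero]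
  have h0 : ∀ U : GaugeConfig 4 ((reg.scheme m z shift).side k) (Matrix.specialUnitaryGroup (Fin 3) ℂ),
      ((List.ofFn fun i => smearedInsertion (reg.scheme m z shift) k U (σ i) (f i)).prod) = 0 := fun U =>
    List.prod_eq_zero ((List.mem_ofFn' _ _).2 ⟨i, by simp only [hi, hΦ]⟩)
  simp [qcdLatticeSchwinger, h0]

/-- **The reference connected calibrating functions of a null species vanish** (for any reference
scheme with `zb(s,k) ≠ 0` on it): the null field `pseudoIm f f` is a constant inside correlation
functions, and truncation kills constants (transfer to the sister scheme with zero counterterm, whose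
null field is literally zero). [folklore] -/
theorem connectedTwoPoint_null (reg : QCDRegularisation Nf) (m : Fin Nf → ℝ)
    (zb shiftb : QCDField Nf → ℕ → ℝ) (k : ℕ) (fl : Fin Nf)
    (hz : zb (QCDField.pseudoIm fl fl) k ≠ 0) (g h : 𝓢(EuclideanSpace ℝ (Fin 4), ℝ)) :
    (reg.scheme m zb shiftb).connectedTwoPoint k (QCDField.pseudoIm fl fl) (QCDField.pseudoIm fl fl) g h = 0 := by
  rw [connectedTwoPoint_transfer reg m zb (fun _ _ => (0 : ℝ)) zb shiftb k _ _ hz hz g h]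
  simp only [QCDScheme.connectedTwoPoint, QCDScheme.twoPoint_eq, QCDScheme.onePoint_eq]
  rw [qcdLatticeSchwinger_null_eq_zero reg m zb _ k ![QCDField.pseudoIm fl fl, QCDField.pseudoIm fl fl] ![g, h]
      (i := 0) (fl := fl) rfl rfl,
    qcdLatticeSchwinger_null_eq_zero reg m zb _ k (fun _ => QCDField.pseudoIm fl fl) (fun _ => g)
      (i := 0) (fl := fl) rfl rfl]
  simp

end Summit.QuantumFields.QCD.Cruxes.RetypedContinuumComplement.VitaliMassDescent

end
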